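import Summits.MatrixMultiplication.OmegaCensus.STPPSmallPatternKernelSearch122R
import Summits.MatrixMultiplication.OmegaCensus.STPPSmallPatternKernelProduct

/-!
# ω-census, `(1,2,2)^4` is infeasible in `ℤ/32` — pruned kernel search, part 12

HONEST FRAMING (pub-omega census; verbatim): lottery ticket; floor = certified bounds/negative ranges.
Census STRUCTURE bookkeeping of the STPP track (seat pub-omega-stpp-3, gen 25; STRUCTURE row B5, the threshold column
`T2(H) = max {k : (1,2,2)^k ⊆ H}`, lower side), not progress on `ω`: small patterns in small groups bound no exponent.

Chunks of `STPP122Neg.search2r (zcode 32) 4` (`decide +kernel`, ≈ 201 s predicted): entries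
`(y, c'₀, xb, xb2, XB, XC, PP)` = fixed start, exclusion masks on the codes of `b₁`, `b'₁`, and the forbidden
difference masks of the start's pair-class rank (`STPPSmallPatternKernelReflect122R.lean`); assembled in `STPPSmallPatternNone122K4Z32.lean`.

References: H. Cohn, R. Kleinberg, B. Szegedy, C. Umans, FOCS 2005 (arXiv:math/0511460), Def. 5.1.
-/

set_option Elab.async false
set_option synthInstance.maxSize 8192
set_option synthInstance.maxHeartbeats 800000

namespace Summit.MatrixMultiplication.OmegaCensus

namespace STPP122Neg

open STPP211Neg

/-- Pruned kernel search (min-flag normal form), `ℤ/32`, `k = 4`, start `(y, c'₀) = (1, 28)`: b₁ ∈ [2]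
(≈ 82 s predicted). -/
theorem Z32k4r.x31 : search2r (zcode 32) 4
    [(1, 28, 1342177224, 0, 0, 0, 7395666254589130590474692005647232352070349181355445286753198770193948844215653148559454132678152226644420642220078925890947218629492447078552183973066233982431119214213915149616380428180833928221470107141282191379651581498451816762181805091580314792860671582288826255985942919419646962511287812950631383040)] = true := by
  decide +kernel

/-- Pruned kernel search (min-flag normal form), `ℤ/32`, `k = 4`, start `(y, c'₀) = (1, 28)`: b₁ ∈ [3, 6]
(≈ 118 s predicted). -/
theorem Z32k4r.x32 : search2r (zcode 32) 4
    [(1, 28, 4294967223, 0, 0, 0, 7395666254589130590474692005647232352070349181355445286753198770193948844215653148559454132678152226644420642220078925890947218629492447078552183973066233982431119214213915149616380428180833928221470107141282191379651581498451816762181805091580314792860671582288826255985942919419646962511287812950631383040)] = true := by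
  decide +kernel

end STPP122Neg

end Summit.MatrixMultiplication.OmegaCensus
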